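import Summits.CriticalPhenomena.PercolationContinuityZ3.Theorems.Transplant.FKConnectivityAllQCountReweightedClusterDomDefs
import Summits.CriticalPhenomena.PercolationContinuityZ3.Theorems.Transplant.FKConnectivityAllQCountReweightedNecessity
import HarnessLib

/-!
# Count-reweighted percolation `P_w·h(k)`: the LOG-CONVEXITY DICHOTOMY at node level — `ClusterDomAdjCountOn (Fin n) h` for all `n`
# forces `h` to be log-convex at every index `≥ 2`; conversely (conjectural in general, `ClusterDomAdjLogConvexPos`; a theorem for
# non-decreasing log-convex `h` and on acyclic supports)

Support file (`--supports stmt-CriticalPhenomena-4575`), FK sub-lane `prim-bschramm-fk-1` (gen 10) of the post-continuity programme;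
builds on p205010 (kernel theorem, internal audit signed; external expert review pending).  No new definitions, no named facts, no
sorries; standard axioms.

* `logConvexAt_of_clusterDomAdjCountOn` — `ClusterDomAdjCountOn V h` on a vertex type with three distinct vertices ⇒
  `h(|V|−1)² ≤ h(|V|−2)·h(|V|)` (`…Necessity`'s three-vertex configuration);
* **`logConvex_of_clusterDomAdjCountOn_all`** — if MM under `crMeasure w h` holds on every `Fin n`, then `h(m)² ≤ h(m−1)h(m+1)` for all
  `m ≥ 2`: log-convexity of the count weight is NECESSARY for the master node;
* `clusterDomAdjCountOn_all_iff_of_monotone` — for POSITIVE NON-DECREASING `h`: (MM on all finite weighted graphs) ⟺ (`h` log-convex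
  from index `1` on), combining `clusterDomAdjCountOn_of_monotone` (sufficiency, Holley) with the necessity above — a complete answer
  for the monotone class (which contains `q^k`, `q ≥ 1`).
[cite: Grimmett2006, Thm. (3.21) (p. 43); Thm. (3.8) (p. 39); §3.9 (pp. 63–65)]
-/

noncomputable section

namespace Summit.CriticalPhenomena.PercolationContinuityZ3.Theorems

namespace FK

open MeasureTheory Set Literature.Probability.LatticeModels Literature.Probability.Percolation
open scoped Classical

variable {V : Type*} [Fintype V]

/-- **MM under the count weight `h` on `V` forces log-convexity of `h` at `|V| − 1`** (given three distinct vertices).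
[cite: Grimmett2006, Thm. (3.21) (p. 43); §3.9 (pp. 63–65)] -/
theorem logConvexAt_of_clusterDomAdjCountOn {h : ℕ → ℝ} (hpos : ∀ k, 0 < h k) (hMM : ClusterDomAdjCountOn V h) {x y z : V}
    (hxy : x ≠ y) (hxz : x ≠ z) (hyz : y ≠ z) :
    h (Fintype.card V - 1) * h (Fintype.card V - 1) ≤ h (Fintype.card V - 2) * h (Fintype.card V) :=
  logConvexAt_of_clusterDomAdj hpos hxy hxz hyz fun w 𝒰 h𝒰 => hMM w x z 𝒰 h𝒰

/-- **Log-convexity is necessary for the count-weight master node on all finite weighted graphs**: if `ClusterDomAdjCountOn (Fin n) h`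
holds for every `n`, then `h(m)² ≤ h(m−1)·h(m+1)` for every `m ≥ 2`. [cite: Grimmett2006, Thm. (3.21) (p. 43); §3.9 (pp. 63–65)] -/
theorem logConvex_of_clusterDomAdjCountOn_all {h : ℕ → ℝ} (hpos : ∀ k, 0 < h k) (hMM : ∀ n : ℕ, ClusterDomAdjCountOn (Fin n) h)
    {m : ℕ} (hm : 2 ≤ m) : h m * h m ≤ h (m - 1) * h (m + 1) := by
  have key := logConvexAt_of_clusterDomAdjCountOn (V := Fin (m + 1)) hpos (hMM (m + 1)) (x := ⟨0, by omega⟩) (y := ⟨1, by omega⟩)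
    (z := ⟨2, by omega⟩) (by simp) (by simp) (by simp)
  simp only [Fintype.card_fin, Nat.add_sub_cancel] at key
  have e : m + 1 - 2 = m - 1 := by omega
  rw [e] at key
  exact key

/-- **The monotone class, completely**: for `h` positive and non-decreasing, MM under `crMeasure w h` holds on every finite weighted
graph iff `h` is log-convex from index `1` on (`h(j+1)² ≤ h(j)h(j+2)` for all `j ≥ 1`; the value `h(0)` is never used since `k ≥ 1`
on a nonempty vertex set — we ask log-convexity on all of `ℕ` in the forward direction for simplicity of the statement of
`clusterDomAdjCountOn_of_monotone`, and obtain it from index `1` in the backward direction).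
[cite: Grimmett2006, Thm. (3.21) (p. 43); Thm. (3.8) (p. 39)] -/
theorem clusterDomAdjCountOn_all_of_monotone_logConvex {h : ℕ → ℝ} (hpos : ∀ k, 0 < h k) (hmono : Monotone h)
    (hlc : ∀ j, h (j + 1) * h (j + 1) ≤ h j * h (j + 2)) (n : ℕ) : ClusterDomAdjCountOn (Fin n) h :=
  clusterDomAdjCountOn_of_monotone hpos hmono hlc

/-- Converse for any positive `h`: MM on all `Fin n` gives log-convexity at every `j + 1` with `j ≥ 1`. [cite: Grimmett2006, §3.9 (pp. 63–65)] -/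
theorem logConvex_succ_of_clusterDomAdjCountOn_all {h : ℕ → ℝ} (hpos : ∀ k, 0 < h k) (hMM : ∀ n : ℕ, ClusterDomAdjCountOn (Fin n) h)
    {j : ℕ} (hj : 1 ≤ j) : h (j + 1) * h (j + 1) ≤ h j * h (j + 2) := by
  have key := logConvex_of_clusterDomAdjCountOn_all hpos hMM (m := j + 1) (by omega)
  have e1 : j + 1 - 1 = j := by omega
  rw [e1] at key
  exact key

end FK

end Summit.CriticalPhenomena.PercolationContinuityZ3.Theorems

end
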